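import Summits.AnomalousDissipation.AnomalousDissipation.Theorems.SolenoidalFractalHomogenisationRealisedQuasiStaticCellLawWeakArithmetic
import Summits.AnomalousDissipation.AnomalousDissipation.Theorems.SolenoidalFractalHomogenisationRealisedQuasiStaticCellLawInPlaneWeightLower
import Summits.AnomalousDissipation.AnomalousDissipation.Theorems.SolenoidalFractalHomogenisationRealisedQuasiStaticCellLawGoodSlot
import Literature.Analysis.FunctionSpaces.TorusHeatSmoothing
import HarnessLib

/-!
# K2R `RealisedQuasiStaticCellLaw`, line `floquet-bloch`, stub `stub_lowSectorWeakFar`: slot algebra of the cubature word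
# for the W-far road (helper; `--supports stmt-AnomalousDissipation-20446`)

Summits-side helper file (everything proved; no definitions, no named facts). Per-slot bookkeeping used to instantiate
`weakSector_decay_of_rates` at the replayed cell word `(cubatureWord.stretch M).stretch (1/ν)`:
* `slots_int_bounds` / `cubature_slot_bounds`: `1 ≤ |m_j|² ≤ 3`, `τ_j ≥ 40` for the 26 slots;
* `cubature_coupling_sq`: the squared coupling `τ_j θ_j²/(2(2π|m_j|)⁴)` IS `slotTerm_j(ℓ, 0)` (`θ_j = ê_j·ℓ`);
* `slotTerm_polar`: `slotTerm(q,0)·(q·m)² = (slotTerm(q,0) − slotTerm(q,q))·|m|²` (in-plane polarisation factor);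
* `slotTerm_zero_nonneg`, `slotTerm_zero_le`: `0 ≤ slotTerm_j(q,0) ≤ τ_j|q|²/(32π⁴)`;
* `dot_cast_facts`, `dot_cast_cellFreq`, `coupling_abs_le`: integer dot products versus `‖latticeVec ·‖`, `|ê·ℓ| ≤ ‖ℓ‖`.
-/

set_option linter.dupNamespace false

noncomputable section

namespace Summit.AnomalousDissipation.AnomalousDissipation.Theorems.SolenoidalFractalHomogenisation.RealisedQuasiStaticCellLaw

open Matrix
open scoped InnerProductSpace Matrix
open Literature.Analysis Literature.Analysis.FunctionSpaces Literature.Analysis.FunctionSpaces.Torus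
open Literature.Analysis.FluidPDE Literature.Analysis.FluidPDE.LatticeShear
open Literature.Algebra.EuclideanLattices (inner_fin_three norm_sq_fin_three)

/-- Integer bounds of the 26 slots: `1 ≤ |m_j|² ≤ 3` and `τ_j ≥ 40`. -/
theorem slots_int_bounds : ∀ j : Fin 26,
    1 ≤ (slots j).m 0 ^ 2 + (slots j).m 1 ^ 2 + (slots j).m 2 ^ 2 ∧
      (slots j).m 0 ^ 2 + (slots j).m 1 ^ 2 + (slots j).m 2 ^ 2 ≤ 3 ∧ 40 ≤ (slots j).τ := by
  decide

/-- The slot fields of the cubature word (definitional). -/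
theorem cubature_phase_fields (j : Fin 26) :
    (cubatureWord.phase j).m = (slots j).m ∧ (cubatureWord.phase j).τ = ((slots j).τ : ℝ) ∧
      (cubatureWord.phase j).e = (1 / Real.sqrt (slots j).n) • latticeVec (slots j).v ∧
      cubatureWord.ramp = 1 / 2 :=
  ⟨rfl, rfl, rfl, rfl⟩

/-- `freqNormSq m` and `‖latticeVec m‖²` in coordinates. -/
theorem freqNormSq_coords (m : Fin 3 → ℤ) :
    freqNormSq m = (m 0 : ℝ) ^ 2 + (m 1 : ℝ) ^ 2 + (m 2 : ℝ) ^ 2 ∧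
      ‖latticeVec m‖ ^ 2 = (m 0 : ℝ) ^ 2 + (m 1 : ℝ) ^ 2 + (m 2 : ℝ) ^ 2 := by
  refine ⟨by unfold freqNormSq; rw [Fin.sum_univ_three], ?_⟩
  rw [norm_sq_fin_three]; simp only [latticeVec_apply]

/-- Real bounds of the slot constants of the cubature word: `1 ≤ |m_j|² ≤ 3`, `|m_j|² = ‖m_j‖²`, `1 ≤ ‖m_j‖`,
`40 ≤ τ_j`. -/
theorem cubature_slot_bounds (j : Fin 26) :
    1 ≤ freqNormSq (cubatureWord.phase j).m ∧ freqNormSq (cubatureWord.phase j).m ≤ 3 ∧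
      ‖latticeVec (cubatureWord.phase j).m‖ ^ 2 = freqNormSq (cubatureWord.phase j).m ∧
      1 ≤ ‖latticeVec (cubatureWord.phase j).m‖ ∧ (40 : ℝ) ≤ (cubatureWord.phase j).τ := by
  obtain ⟨hm, hτ, -, -⟩ := cubature_phase_fields j
  obtain ⟨h1, h3, h40⟩ := slots_int_bounds j
  obtain ⟨hF, hN⟩ := freqNormSq_coords (slots j).m
  rw [hm, hτ]
  have h1' : (1 : ℝ) ≤ ((slots j).m 0 : ℝ) ^ 2 + ((slots j).m 1 : ℝ) ^ 2 + ((slots j).m 2 : ℝ) ^ 2 := by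
    exact_mod_cast h1
  have h3' : ((slots j).m 0 : ℝ) ^ 2 + ((slots j).m 1 : ℝ) ^ 2 + ((slots j).m 2 : ℝ) ^ 2 ≤ 3 := by
    exact_mod_cast h3
  refine ⟨by rw [hF]; exact h1', by rw [hF]; exact h3', by rw [hF, hN], ?_, by exact_mod_cast h40⟩
  have hn2 : 1 ≤ ‖latticeVec (slots j).m‖ ^ 2 := by rw [hN]; exact h1'
  nlinarith [norm_nonneg (latticeVec (slots j).m)]

/-- **The squared coupling is the slot term**: `τ_j·(1/(2(2π‖m_j‖)⁴))·θ_j² = slotTerm_j(ℓ, 0)` with `θ_j = ê_j·ℓ`. -/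
theorem cubature_coupling_sq (j : Fin 26) (ℓ : Fin 3 → ℤ) :
    (cubatureWord.phase j).τ * (1 / (2 * (2 * Real.pi * ‖latticeVec (cubatureWord.phase j).m‖) ^ 4)) *
        (∑ i, (cubatureWord.phase j).e i * (ℓ i : ℝ)) ^ 2 = slotTerm (slots j) (latticeVec ℓ) 0 := by
  obtain ⟨hm, hτ, he, -⟩ := cubature_phase_fields j
  have hok := slots_ok j
  have hn : (0 : ℝ) < (slots j).n := by exact_mod_cast hok.2.1
  obtain ⟨h1, -, -⟩ := slots_int_bounds j
  have hS : (0 : ℝ) < ((slots j).m 0 : ℝ) ^ 2 + ((slots j).m 1 : ℝ) ^ 2 + ((slots j).m 2 : ℝ) ^ 2 := by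
    have : (1 : ℝ) ≤ ((slots j).m 0 : ℝ) ^ 2 + ((slots j).m 1 : ℝ) ^ 2 + ((slots j).m 2 : ℝ) ^ 2 := by exact_mod_cast h1
    linarith
  have hN4 : ‖latticeVec (slots j).m‖ ^ 4 = (((slots j).m 0 : ℝ) ^ 2 + ((slots j).m 1 : ℝ) ^ 2 + ((slots j).m 2 : ℝ) ^ 2) ^ 2 := by
    rw [show (4 : ℕ) = 2 * 2 from rfl, pow_mul, (freqNormSq_coords (slots j).m).2]
  obtain ⟨r, hr, hrn⟩ : ∃ r : ℝ, r = Real.sqrt (slots j).n ∧ r ^ 2 = (slots j).n :=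
    ⟨_, rfl, Real.sq_sqrt hn.le⟩
  have hrpos : 0 < r := by rw [hr]; exact Real.sqrt_pos.2 hn
  have hsum : ∑ i, (cubatureWord.phase j).e i * (ℓ i : ℝ) =
      (1 / r) * (((slots j).v 0 : ℝ) * (ℓ 0 : ℝ) + (slots j).v 1 * (ℓ 1 : ℝ) + (slots j).v 2 * (ℓ 2 : ℝ)) := by
    rw [he, Fin.sum_univ_three, ← hr]
    simp only [PiLp.smul_apply, smul_eq_mul, latticeVec_apply]
    ring
  rw [hτ, hm, hsum, mul_pow (2 * Real.pi) ‖latticeVec (slots j).m‖ 4, hN4]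
  unfold slotTerm
  simp only [latticeVec_apply, PiLp.zero_apply, zero_mul, add_zero]
  rw [← hrn]
  field_simp
  ring

/-- **In-plane polarisation factor**: `slotTerm(q,0)·(q·m)² = (slotTerm(q,0) − slotTerm(q,q))·|m|²`. -/
theorem slotTerm_polar (d : SlotData) (q : EuclideanSpace ℝ (Fin 3)) :
    slotTerm d q 0 * (q 0 * d.m 0 + q 1 * d.m 1 + q 2 * d.m 2) ^ 2 =
      (slotTerm d q 0 - slotTerm d q q) * ((d.m 0 : ℝ) ^ 2 + (d.m 1 : ℝ) ^ 2 + (d.m 2 : ℝ) ^ 2) := by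
  unfold slotTerm
  simp only [PiLp.zero_apply, zero_mul, add_zero]
  ring

/-- `0 ≤ slotTerm_j(q, 0)`. -/
theorem slotTerm_zero_nonneg (j : Fin 26) (q : EuclideanSpace ℝ (Fin 3)) : 0 ≤ slotTerm (slots j) q 0 := by
  unfold slotTerm
  simp only [PiLp.zero_apply, zero_mul, add_zero]
  have hS : (0 : ℝ) ≤ ((slots j).m 0 : ℝ) ^ 2 + ((slots j).m 1 : ℝ) ^ 2 + ((slots j).m 2 : ℝ) ^ 2 := by positivity
  have hn : (0 : ℝ) ≤ (slots j).n := by positivity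
  have hτ : (0 : ℝ) ≤ (slots j).τ := by positivity
  rw [zero_pow two_ne_zero, sub_zero]
  positivity

/-- `slotTerm_j(q, 0) ≤ τ_j|q|²/(32π⁴)` (Cauchy–Schwarz `(v·q)² ≤ |v|²|q|²`, `|m_j| ≥ 1`). -/
theorem slotTerm_zero_le (j : Fin 26) (q : EuclideanSpace ℝ (Fin 3)) :
    slotTerm (slots j) q 0 ≤ (slots j).τ * (q 0 ^ 2 + q 1 ^ 2 + q 2 ^ 2) / (32 * Real.pi ^ 4) := by
  have hok := slots_ok j
  obtain ⟨h1, -, -⟩ := slots_int_bounds j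
  have hn : (0 : ℝ) < (slots j).n := by exact_mod_cast hok.2.1
  have hv : ((slots j).v 0 : ℝ) ^ 2 + ((slots j).v 1 : ℝ) ^ 2 + ((slots j).v 2 : ℝ) ^ 2 = (slots j).n := by
    have := hok.2.2.1; exact_mod_cast this
  have hS1 : (1 : ℝ) ≤ ((slots j).m 0 : ℝ) ^ 2 + ((slots j).m 1 : ℝ) ^ 2 + ((slots j).m 2 : ℝ) ^ 2 := by exact_mod_cast h1
  unfold slotTerm
  simp only [PiLp.zero_apply, zero_mul, add_zero]
  rw [zero_pow two_ne_zero, sub_zero]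
  set S : ℝ := ((slots j).m 0 : ℝ) ^ 2 + ((slots j).m 1 : ℝ) ^ 2 + ((slots j).m 2 : ℝ) ^ 2 with hSdef
  set A : ℝ := q 0 ^ 2 + q 1 ^ 2 + q 2 ^ 2
  have hτ : (0 : ℝ) ≤ (slots j).τ := by positivity
  have hCS : (((slots j).v 0 : ℝ) * q 0 + (slots j).v 1 * q 1 + (slots j).v 2 * q 2) ^ 2 ≤ (slots j).n * A := by
    rw [← hv]
    nlinarith [sq_nonneg (((slots j).v 0 : ℝ) * q 1 - (slots j).v 1 * q 0),
      sq_nonneg (((slots j).v 0 : ℝ) * q 2 - (slots j).v 2 * q 0),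
      sq_nonneg (((slots j).v 1 : ℝ) * q 2 - (slots j).v 2 * q 1)]
  have hSpos : 0 < S := by linarith
  rw [div_le_div_iff₀ (by positivity) (by positivity)]
  have hA : 0 ≤ A := by positivity
  -- `τ (v·q)² S · 32π⁴ ≤ τ A · 2 (2π)⁴ n S³` since `(v·q)² ≤ nA` and `S ≤ S³`
  have hS3 : S ≤ S ^ 3 := by
    have e : S ^ 3 - S = S * (S - 1) * (S + 1) := by ring
    have : 0 ≤ S * (S - 1) * (S + 1) := by
      have h0 : 0 ≤ S - 1 := sub_nonneg.2 hS1
      positivity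
    linarith
  have h2π : (2 * Real.pi) ^ 4 = 16 * Real.pi ^ 4 := by ring
  rw [h2π]
  have hπ : 0 < Real.pi ^ 4 := by positivity
  nlinarith [mul_le_mul hCS hS3 hSpos.le (by positivity : (0:ℝ) ≤ (slots j).n * A), hτ,
    mul_nonneg (mul_nonneg hτ (sub_nonneg.2 (mul_le_mul hCS hS3 hSpos.le (by positivity : (0:ℝ) ≤ (slots j).n * A)))) hπ.le]

/-- Integer dot products versus `latticeVec`: `ℓ·ℓ = ‖ℓ‖²`, `√(ℓ·ℓ) = ‖ℓ‖`, `|ℓ·K| ≤ ‖ℓ‖‖K‖`. -/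
theorem dot_cast_facts (ℓ K : Fin 3 → ℤ) :
    (fun i => ((ℓ i : ℤ) : ℝ)) ⬝ᵥ (fun i => ((ℓ i : ℤ) : ℝ)) = ‖latticeVec ℓ‖ ^ 2 ∧
      Real.sqrt ((fun i => ((ℓ i : ℤ) : ℝ)) ⬝ᵥ (fun i => ((ℓ i : ℤ) : ℝ))) = ‖latticeVec ℓ‖ ∧
      |(fun i => ((ℓ i : ℤ) : ℝ)) ⬝ᵥ (fun i => ((K i : ℤ) : ℝ))| ≤ ‖latticeVec ℓ‖ * ‖latticeVec K‖ := by
  have h1 : (fun i => ((ℓ i : ℤ) : ℝ)) ⬝ᵥ (fun i => ((ℓ i : ℤ) : ℝ)) = ‖latticeVec ℓ‖ ^ 2 := by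
    rw [← freqNormSq_eq_dotProduct, norm_latticeVec_sq]
  refine ⟨h1, by rw [h1, Real.sqrt_sq (norm_nonneg _)], ?_⟩
  have h2 : (fun i => ((ℓ i : ℤ) : ℝ)) ⬝ᵥ (fun i => ((K i : ℤ) : ℝ)) = ⟪latticeVec ℓ, latticeVec K⟫_ℝ := by
    rw [← sum_mul_intCast_eq_inner, dotProduct]
    refine Finset.sum_congr rfl fun i _ => ?_
    rw [latticeVec_apply]
  rw [h2]
  exact abs_real_inner_le_norm _ _

/-- The cell dot products in coordinates: `ℓ·(n m) = n (ℓ·m)`, `‖n m‖ = n‖m‖`. -/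
theorem dot_cast_cellFreq (ℓ m : Fin 3 → ℤ) (n : ℕ) :
    (fun i => ((ℓ i : ℤ) : ℝ)) ⬝ᵥ (fun i => (((fun i => m i * (n : ℤ)) i : ℤ) : ℝ)) =
        (n : ℝ) * ((latticeVec ℓ) 0 * m 0 + (latticeVec ℓ) 1 * m 1 + (latticeVec ℓ) 2 * m 2) ∧
      ‖latticeVec (fun i => m i * (n : ℤ))‖ = (n : ℝ) * ‖latticeVec m‖ := by
  refine ⟨?_, ?_⟩
  · rw [dotProduct, Fin.sum_univ_three]
    simp only [latticeVec_apply]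
    push_cast
    ring
  · have h : ‖latticeVec (fun i => m i * (n : ℤ))‖ ^ 2 = ((n : ℝ) * ‖latticeVec m‖) ^ 2 := by
      rw [mul_pow, norm_latticeVec_sq, norm_latticeVec_sq, (freqNormSq_coords _).1, (freqNormSq_coords _).1]
      push_cast
      ring
    have hn : (0 : ℝ) ≤ (n : ℝ) * ‖latticeVec m‖ := by positivity
    nlinarith [norm_nonneg (latticeVec (fun i => m i * (n : ℤ))), sq_nonneg (‖latticeVec (fun i => m i * (n : ℤ))‖ - (n : ℝ) * ‖latticeVec m‖)]

/-- The coupling is at most the sector norm: `|ê·ℓ| ≤ ‖ℓ‖` (`ê` a unit vector). -/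
theorem coupling_abs_le (P : LatticePhase) (ℓ : Fin 3 → ℤ) :
    |∑ i, P.e i * (ℓ i : ℝ)| ≤ ‖latticeVec ℓ‖ := by
  rw [sum_mul_intCast_eq_inner]
  have h := abs_real_inner_le_norm P.e (latticeVec ℓ)
  rw [P.e_unit, one_mul] at h
  exact h

end Summit.AnomalousDissipation.AnomalousDissipation.Theorems.SolenoidalFractalHomogenisation.RealisedQuasiStaticCellLaw

end
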